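import Mathlib
import HarnessLib
import Literature.Analysis.FluidPDE.SelfSimilar
import Literature.Analysis.FluidPDE.OseenMildUniqueness
import Literature.Analysis.UnboundedOperators.HeatKernel
import Summits.NavierStokesRegularity.NavierStokesRegularity.Theorems.LocalSineTubeDoorProfileAlignedWindowRigidityAncient

/-!
# K2 `PoloidalWindowRigidity` (stmt-NavierStokesRegularity-19708) — a Type-I, continuous, Oseen-mild ancient
# field is jointly real-analytic in space–time on `(-∞,0) × ℝ³`

Landing (seat ns-es-p1 g2, director-ns KEY-NS #63 (1) / #64 (1)) of the crux workfile
`Cruxes/PoloidalWindowRigidity/TypeIAnalytic.lean` v2 (planner ns-idea-8 g0), statements VERBATIM, so that the two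
crux lines on stmt-NavierStokesRegularity-19708 that consume it — `Lines/entire_slices.lean` (stubs S1/S4, prices R4/P5)
and `Lines/string_shells.lean` (`stub_thGlobalLaw`, price P1) — can cite it BY NAME (a Cruxes workfile is not
importable from `Theorems/`).

Content.  The route's Type-I profile class — Type-I time decay `‖v(t,x)‖ ≤ C/√(−t)` (`HasTypeITimeDecay`), `uncurry v`
continuous on the open slab `(−∞,0) × ℝ³`, unit-viscosity Oseen-mild from every past time
`v t x = heatExtension (v s) (t − s) x − oseenDuhamel 1 s v v t x` (`s < t < 0`) — is jointly real-analytic on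
the slab (`typeI_mild_analyticOnNhd`), and in particular every negative-time slice is real-analytic on `ℝ³`
(`typeI_mild_slice_analytic`).  Both are ONE TERM over the tree theorems
`…Theorems.LocalSineTubeDoorProfileAlignedWindowRigidityAncient.analyticOnNhd_uncurry` / `.analyticOnNhd_slice`
(joint real-analyticity of Oseen-mild ancient fields bounded on every `(−∞,−δ)`; underneath:
`Literature.Analysis.FluidPDE.lemarieRieusset2016_local_analyticity_holds`, Lemarié-Rieusset 2016 Thm 9.12, and
bounded-mild uniqueness `Literature.Analysis.FluidPDE.oseenMild_essBounded_unique`) composed with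
`.bdd_of_hasTypeITimeDecay` (Type-I ⇒ those bounds).  The critic's price «(M)+Type-I ⇒ real-analyticity is a fact
not in the tree» (idea-crit-7, 03:16:10Z R4 / 04:03:24Z P1) was withdrawn 04:19:14Z: it IS in the tree, proved.

WHAT THIS IS NOT: not a claim about Navier–Stokes regularity, not the crux `PoloidalWindowRigidity`, not a stub of
either line — a by-name re-export of proved tree analyticity in the exact hypothesis shape the two lines use
(`--supports stmt-NavierStokesRegularity-19708`).  No summit statement is proved here.
-/

noncomputable section

-- the summit and its single sub-problem share the name (CONVENTIONS §1), as in every Theorems file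
set_option linter.dupNamespace false

namespace Summit.NavierStokesRegularity.NavierStokesRegularity.Theorems.PoloidalWindowDoorPoloidalWindowRigidityTypeIAnalytic

open Set Function MeasureTheory
open Literature.Analysis Literature.Analysis.FluidPDE Literature.Analysis.UnboundedOperators
open Summit.NavierStokesRegularity.NavierStokesRegularity.Theorems.LocalSineTubeDoorProfileAlignedWindowRigidityAncient

/-- **Type-I + continuity + Oseen-mild from every past time ⇒ joint real-analyticity on `(-∞, 0) × ℝ³`.**
For `v : ℝ → ℝ³ → ℝ³` with Type-I time decay `‖v t x‖ ≤ C/√(−t)` (`t < 0`), `uncurry v` continuous on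
`Iio 0 ×ˢ univ`, and the unit-viscosity Oseen (mild) identity from every `s < t < 0`, the map `(t,x) ↦ v t x` is
real-analytic at every point of the open slab.  One term over the tree theorem `analyticOnNhd_uncurry`
(Lemarié-Rieusset 2016 Thm 9.12 + bounded-mild uniqueness, via `lemarieRieusset2016_local_analyticity_holds` /
`oseenMild_essBounded_unique`) and `bdd_of_hasTypeITimeDecay`.  Statement verbatim from the crux workfile
`Cruxes/PoloidalWindowRigidity/TypeIAnalytic.lean` v2 (ns-idea-8 g0). -/
theorem typeI_mild_analyticOnNhd (C : ℝ)
    (v : ℝ → EuclideanSpace ℝ (Fin 3) → EuclideanSpace ℝ (Fin 3))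
    (hT : HasTypeITimeDecay C v)
    (hcont : ContinuousOn (uncurry v) (Iio (0 : ℝ) ×ˢ univ))
    (hmild : ∀ s t : ℝ, s < t → t < 0 → ∀ x,
      v t x = heatExtension (v s) (t - s) x - oseenDuhamel 1 s v v t x) :
    AnalyticOnNhd ℝ (uncurry v) (Iio (0 : ℝ) ×ˢ (univ : Set (EuclideanSpace ℝ (Fin 3)))) :=
  analyticOnNhd_uncurry hcont (bdd_of_hasTypeITimeDecay hT) hmild

/-- **Corollary used by the lines: every negative-time slice is real-analytic in space.**  Under the hypotheses
of `typeI_mild_analyticOnNhd`, `v s` is real-analytic on all of `ℝ³` for every `s < 0` (tree theorem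
`analyticOnNhd_slice`: restrict the jointly analytic `uncurry v` along the analytic map `x ↦ (s, x)`).  Statement
verbatim from the crux workfile `Cruxes/PoloidalWindowRigidity/TypeIAnalytic.lean` v2. -/
theorem typeI_mild_slice_analytic (C : ℝ)
    (v : ℝ → EuclideanSpace ℝ (Fin 3) → EuclideanSpace ℝ (Fin 3))
    (hT : HasTypeITimeDecay C v)
    (hcont : ContinuousOn (uncurry v) (Iio (0 : ℝ) ×ˢ univ))
    (hmild : ∀ s t : ℝ, s < t → t < 0 → ∀ x,
      v t x = heatExtension (v s) (t - s) x - oseenDuhamel 1 s v v t x) :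
    ∀ s < 0, AnalyticOnNhd ℝ (v s) univ :=
  fun _ hs => analyticOnNhd_slice hcont (bdd_of_hasTypeITimeDecay hT) hmild hs

end Summit.NavierStokesRegularity.NavierStokesRegularity.Theorems.PoloidalWindowDoorPoloidalWindowRigidityTypeIAnalytic

end
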